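/-
Copyright (c) 2026 the pub-hodgecm-mathlib formalisation cell (harness21).  Prover seat hodgecm-mathlib-B-p08 (g41) = tier-1 ASSEMBLER of unit U2G_Census (heir LEAD F0P3a-plan
T17-31 (R-9)∕(R-10); dealer LH4-plan (g10) WORD #8 (6)∕#10 (4); desk F0P3-plan (g21) INVENTORY v1 56a02b7f4f575bad §U2G); tier-1 SOCKET MODULE of the unit; 2026-09-03.
-/
import Summits.HodgeConjecture.HodgeConjecture.Theorems.F0P3cDyRamFourFrameCensusDefs          -- DEFS LEAF of the unit (B-p08 (g41)): `PieceCountDictionary`, `cntStar`, `cntEdge`, the profile counts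
import Summits.HodgeConjecture.HodgeConjecture.Theorems.F0P3cDyRamPieceCountDictionaryUnit0    -- TIER 2 (B-p08 (g41)): `pieceCountDictionary_unit0 : PieceCountDictionary pieceUnit0 cntUnit0` — PAID
import Summits.HodgeConjecture.HodgeConjecture.Theorems.F0P3cDyRamPieceCountDictionaryProfiles -- TIER 2 (B-p08 (g41), ★ p854797): `pieceCountDictionary_transvPlus ∕ _transvMinus ∕ _reg` — PAY `stub_U2G_dict_transvPlus ∕ _transvMinus ∕ _reg` BY NAME (ED. 2)
import Summits.HodgeConjecture.HodgeConjecture.Theorems.F0P3cDyRamAnchorCountDictionaryZero   -- ★ p854635 (LH4-p01 (g17)): (D-G) `anchorCountDictionary_zero : AnchorCountDictionary 0`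
import Literature.NumberTheory.Automorphic.UnitaryThreeFourFrameFixedVertexCriterion          -- ★ p854623 (B-p08 (g41)): unit (i)⊕ A-0 ⊕ A-1 in closed form (the counting reading)
import Summits.HodgeConjecture.HodgeConjecture.Theorems.F0P3cDyRamPieceCountDictionaryEdge   -- ★ (LH4-p01 g17): `pieceCountDictionary_edge` — PAYS `stub_U2G_dict_edge` BY NAME
import HarnessLib

/-!
# Crux `H413`, line LH4 «(D-RAM) FOUR-FRAME» road — TIER-1 SOCKET MODULE **U2G_Census** «G-SIDE CENSUS DICTIONARY» (LEAD T17-31 (R-9); desk INVENTORY v1 §U2G) — ED. 3 (4 of 4 dictionary stubs PAID as theorem lines — UNIT U2G SORRY-FREE: ★ p854688 unit0, ★ p854797 transvPlus∕transvMinus∕reg, ★ `F0P3cDyRamPieceCountDictionaryEdge` edge; signatures byte-identical to ED. 1 24dcc47e4cfc92fe; export `unitTwoG_pieceCountDictionary_gselStar` sorry-free)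

Cell `hodgecm-mathlib` (D-0151), FLOOR 0, crux item H413 = `stmt-HodgeConjecture-24833`, route of record `HCCMUnconditional`; squad F0∕P3c∕LH4 (req618, director s1808);
sibling line `Cruxes/H413/Lines/F0_P3c_DyRamFourFrame.lean` (tier 0, dealer LH4-plan (g10): six registered stubs `stub_rows_unit0 ∕ transvPlus ∕ transvMinus ∕ regular : PieceRowsWild
gselStar j`, `stub_pieceProps`, `stub_rankTableWild` + the ★ spine `anchorRowsWild_of_slices → rankTransferWild_of_anchorRows → dyRamCore_of_rankTransferWild → stub_DyRamCore`).
THIS MODULE is the tier-1 socket of unit (ii-G) per (R-9): every planned theorem of the unit as `theorem stub_U2G_<name> : ‹statement over ★ DEFS names› := by sorry` + the unit's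
sorry-free ASSEMBLY; tier-2 prover files (`Theorems/F0P3cDyRam*.lean`, `--supports stmt-HodgeConjecture-24833`) prove the stubs' statements BY NAME.  Assembler B-p08 (g41)
(bus 2026-09-03 20:14Z plan v1; «=∕≠» window honoured).  Imports: the unit's ★ DEFS LEAF `Theorems/F0P3cDyRamFourFrameCensusDefs.lean` (`PieceCountDictionary g cnt`, count
selectors `cntUnit0 ∕ cntTransvPlus ∕ cntTransvMinus ∕ cntReg` = `cntStar`, `cntEdge`; over ★ №3 `F0P3cDyRamFourFramePieces` `gselStar = (1_K, f_{T+}, f_{T−}, f_reg)`, `pieceEdge`),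
★ p854635 (D-G) at `t = 0`, ★ p854623 unit (i)⊕.  Sorries ONLY in `stub_U2G_*`; no `def`, no instance, no notation, no free constant ((R-10)(b)), no `∃`-witness shared across stubs
((R-10)(c)); every stub binds the place datum (σ-stable wild ramified `w`, `e ≠ 1`, `2 ∉ 𝒪_w^×`, uniformiser — the binder block of (D-G) VERBATIM, (R-10)(a)); no census LAW is
stated here ((R-10)(d): the laws live in ★ №1 `F0P3cDyRamFourFrameLawDefs` and are unit U3's stubs; U2G's tier-2 COUNT theorems prove them `--supports` against U3's names —
ONE home, no double count); rows (2)(3) of the pieces are unit U4's row identities (desk «count once»).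

WHAT THE UNIT DELIVERS BY NAME (consumed by U4_Rows' `stub_U4_rows_*` ∕ `stub_U4_table_*` and by the §4-type row theorems): for EACH explicit piece of the tier-0 selector
`gselStar j` and for the edge piece `g_E`, the CENSUS DICTIONARY on the type-(1) population — `Φ(⟦γ⟧, piece; mG₃) = νG₃(K) · count(ι_w γ)` with ONE EXPLICIT constant `νG₃(K)`,
`K = cmLocalIntegralLevel` (so U4's 4 × 4 piece table is in one normalisation — the desk's `measure_normalisation` row is thereby a clause of each dictionary, not a separate stub):
* §0 PAID ★ BY NAME: (D-G) `AnchorCountDictionary 0` (★ p854635 `anchorCountDictionary_zero`, LH4-p01) and unit (i)⊕ `exists_invariants_mapGL_latt_eq_iff` (★ p854623).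
* §1 `dict_unit0` PAID (`unitTwoG_dict_unit0 := pieceCountDictionary_unit0`, tier-2 file `F0P3cDyRamPieceCountDictionaryUnit0` — re-pinned to `K`, explicit constant); ED. 2:
  `stub_U2G_dict_transvPlus ∕ transvMinus ∕ reg` PAID BY NAME (★ p854797 `F0P3cDyRamPieceCountDictionaryProfiles.pieceCountDictionary_transvPlus ∕ _transvMinus ∕ _reg`, statements
  unchanged), ONE open REGISTERED-SHAPE STUB `stub_U2G_dict_edge` (LH4-p01 (g17)); originally FOUR
  REGISTERED-SHAPE STUBS `stub_U2G_dict_transvPlus ∕ transvMinus ∕ reg ∕ edge : PieceCountDictionary ‹piece› ‹count›` — desk rows `dict_transvection` (split ± per WORD #10), `dict_regular`, `dict_edge` (count = fixed EDGES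
  `fixedEdgeCount`, NOT the root-local `edgeFixCount`).  Tier-2 road for §1 (2–4 files each): ★ `classOrbitalIntegral_indicator_complex_local_eq_natCard_fixedBy_mul`-type
  fixed-coset sum with an `Ad K`-invariant weight + ★ `UnitaryLatticeTreeFixedCosetStrataDictionary`-type label transport (`InLevel ↔ LatticeInLevel`, `valueSetMod(g⁻¹Xg) =
  latticeValueSetMod (g·𝒪³) X` for unitary `g`) + htr₀-wild ★ p854568; the desk's `kConj_classes_in_K` is a tier-2 helper of these proofs, not a statement a consumer cites.
* §2 ASSEMBLY (sorry-free): `pieceCountDictionary_gselStar_of` (hypothesis form, TRIO) and `unitTwoG_pieceCountDictionary_gselStar : ∀ j : Fin 4, PieceCountDictionary (gselStar j)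
  (cntStar j)` + `unitTwoG_pieceCountDictionary_edge` — the unit's exports.
DESK ACCOUNTING (INVENTORY v1 §U2G n = 19 → this module 5, of which 1 PAID): `n0_law_row1_RP∕RU`, `n2_law_row1`, `T_count_row1`, `reg_count_row1` = U3's law stubs BY NAME (their proofs are
U2G tier-2 files); `counts_row2∕row3_<piece>` ×8 = U4's row identities; `measure_normalisation` folded into the explicit constant; `kConj_classes_in_K` tier-2 helper;
`dict_transvection` split into ±.  «≠» from dealer ∕ desk ∕ p01 re-cuts this in v2.
HONEST LABEL: every `stub_U2G_*` is typing debt of an in-house road; the census dictionaries are PROVER TARGETS, not facts; the verdict of record for (D-RAM) stays PRINT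
[LanglandsShelstad1989 Thm. p. 484 ∕ Rogawski1990 Prop. 4.9.1 (a)] ∕ XL; `HC_CM` is proved only modulo the 7 printed citations (2 remaining named inputs: hLiu418 =
`stmt-HodgeConjecture-24832`, h413 = `stmt-HodgeConjecture-24833`) until rung 0 closes.

## References
* [Kottwitz1986] R. E. Kottwitz, *Base change for unit elements of Hecke algebras*, Compositio Math. 60 (1986), §3 (fixed points on the building; strata by congruence level).
* [Rogawski1990] J. D. Rogawski, *Automorphic Representations of Unitary Groups in Three Variables*, Ann. of Math. Stud. 123 (1990), §4.9 Prop. 4.9.1 (b) p. 55.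
* [Laumon1995] G. Laumon, *Cohomology of Drinfeld Modular Varieties I* (1996), Lemma (5.3.2) p. 136.
-/

noncomputable section

namespace Summit.HodgeConjecture.HodgeConjecture.Cruxes.H413.F0P3cDyRamFourFrame.U2GCensus

open Literature.NumberTheory.Automorphic.UnitaryThreeFourFrame
open Summit.HodgeConjecture.HodgeConjecture.Cruxes.H413.F0P3cDyRamFourFramePieces
open Summit.HodgeConjecture.HodgeConjecture.Cruxes.H413.F0P3cDyRamFourFrameCensusDefs
open Summit.HodgeConjecture.HodgeConjecture.Cruxes.H413.F0P3cDyRamFourFrameDictionaryDefs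
open Summit.HodgeConjecture.HodgeConjecture.Cruxes.H413.F0P3cDyRamAnchorCountDictionaryZero
open Summit.HodgeConjecture.HodgeConjecture.Cruxes.H413

/-! ## §0  The proved part of unit (ii-G), BY NAME (no `sorry`) -/

/-- **(D-G) AT THE TYPE-0 ANCHOR (★ p854635, LH4-p01 (g17))**: `AnchorCountDictionary 0` — `Φ(⟦γ⟧, 1_{K₀}) = C₀ · n₀(Γ_b)` for every type-(1) literal. [cite: Kottwitz1986BaseChangeUnits, §1 pp. 240–241] -/
theorem unitTwoG_anchorCountDictionary_zero : AnchorCountDictionary 0 := anchorCountDictionary_zero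

/-! ## §1  The registered-shape stubs of unit (ii-G): one census dictionary per explicit piece (type-(1) population) -/

/-- **U2G-0 · `dict_unit0` — PAID (tier 2, B-p08 (g41) `F0P3cDyRamPieceCountDictionaryUnit0`): THE ANCHOR DICTIONARY RE-PINNED TO `K` WITH THE EXPLICIT CONSTANT**,
`Φ(⟦γ⟧, 1_K; mG₃) = νG₃(K) · n₀(ι_w γ)` on the type-(1) population (`K = cmLocalIntegralLevel` = the stabiliser of `𝒪_w³`; ★ p854635 at the root + ★ `mem_localIntegralLevel_iff_of_smul_eq`
+ ★ `mapGL_stdLattice_eq_iff_mem_glInt` + ★ `fixedVertexCount_eq_of_coe_eq_smul`). [cite: Kottwitz1986BaseChangeUnits, §1 pp. 240–241] [cite: Rogawski1990, §4.9 Prop. 4.9.1 (b) p. 55] -/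
theorem unitTwoG_dict_unit0 : PieceCountDictionary pieceUnit0 cntUnit0 := F0P3cDyRamPieceCountDictionaryUnit0.pieceCountDictionary_unit0

/-- **STUB U2G-1 · `dict_transvPlus` — THE CENSUS DICTIONARY OF THE PIECE `f_{T+}`**: `Φ(⟦γ⟧, f_{T+}; mG₃) = νG₃(K) · #{type-0 vertices M fixed by ι_w γ at which ι_w γ − 1 is in
the near-transvection shell `(ℓ₀, m*)` with label `+`}` (`ℓ₀ = d % 2`, `m* = mstarFn`, `d = dOfPlace`; count `transvPlusFixCount`).  Size M: weighted fixed-coset formula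
(`f_{T+} = 1_{K ∩ P}`, `P` `Ad K`-invariant) + label transport to the vertex (`InLevel ∕ valueSetMod` of `g⁻¹Xg` ↔ `LatticeInLevel ∕ latticeValueSetMod` at `g·𝒪³`, `g` unitary) +
htr₀-wild ★ p854568. [cite: Kottwitz1986BaseChangeUnits, §1 pp. 240–241] [cite: Rogawski1990, §4.9 Prop. 4.9.1 (b) p. 55] -/
theorem stub_U2G_dict_transvPlus : PieceCountDictionary pieceTransvPlus cntTransvPlus :=
  F0P3cDyRamPieceCountDictionaryProfiles.pieceCountDictionary_transvPlus

/-- **STUB U2G-2 · `dict_transvMinus` — THE CENSUS DICTIONARY OF THE PIECE `f_{T−}`** (shell `(ℓ₀, m*)`, label `−` = `¬ LabelPlus`; count `transvMinusFixCount`).  Same road as U2G-1.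
[cite: Kottwitz1986BaseChangeUnits, §1 pp. 240–241] [cite: Rogawski1990, §4.9 Prop. 4.9.1 (b) p. 55] -/
theorem stub_U2G_dict_transvMinus : PieceCountDictionary pieceTransvMinus cntTransvMinus :=
  F0P3cDyRamPieceCountDictionaryProfiles.pieceCountDictionary_transvMinus

/-- **STUB U2G-3 · `dict_reg` — THE CENSUS DICTIONARY OF THE REGULAR-PROFILE PIECE `f_reg`**: `Φ(⟦γ⟧, f_reg; mG₃) = νG₃(K) · #{type-0 vertices M fixed by ι_w γ with (ι_w γ − 1)²·M ⊄
ϖ^{m*}·M}` (count `regFixCount`).  Same road as U2G-1 without the label. [cite: Kottwitz1986BaseChangeUnits, §1 pp. 240–241] [cite: Rogawski1990, §4.9 Prop. 4.9.1 (b) p. 55] -/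
theorem stub_U2G_dict_reg : PieceCountDictionary pieceReg cntReg :=
  F0P3cDyRamPieceCountDictionaryProfiles.pieceCountDictionary_reg

/-- **STUB U2G-4 · `dict_edge` — THE CENSUS DICTIONARY OF THE EDGE PIECE `g_E`** ((K-1)(c); `g_E(u) = 1_K(u)·#{type-2 neighbours N of 𝒪_w³ with ι_w(u)·N = N}` = `Σ_N 1_{K ∩ Stab N}`):
`Φ(⟦γ⟧, g_E; mG₃) = νG₃(K) · e(ι_w γ)`, `e = fixedEdgeCount` = the number of FIXED EDGES (flags `N < M`, type 2 below type 0, both fixed) — summing the root-local `edgeFixCount`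
over the fixed type-0 cosets.  Size S–M. [cite: Kottwitz1986BaseChangeUnits, §1 pp. 240–241] [cite: Rogawski1990, §4.9 Prop. 4.9.1 (b) p. 55] -/
theorem stub_U2G_dict_edge : PieceCountDictionary pieceEdge cntEdge :=
  Summit.HodgeConjecture.HodgeConjecture.Cruxes.H413.F0P3cDyRamPieceCountDictionaryEdge.pieceCountDictionary_edge  -- PAID ★ `F0P3cDyRamPieceCountDictionaryEdge` (LH4-p01 (g17))

/-! ## §2  The unit assembly: the dictionaries of the tier-0 selector `gselStar` and of `g_E`, BY NAME — sorry-free given the stubs -/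

/-- **UNIT (ii-G) ASSEMBLY, HYPOTHESIS FORM (TRIO)**: the four piece dictionaries give the dictionary of every component of the tier-0 selector `gselStar = (1_K, f_{T+}, f_{T−}, f_reg)`
with the matching count selector `cntStar = (n₀, n_{T+}, n_{T−}, n_reg)`. [cite: Kottwitz1986BaseChangeUnits, §1 pp. 240–241] -/
theorem pieceCountDictionary_gselStar_of (h0 : PieceCountDictionary pieceUnit0 cntUnit0) (h1 : PieceCountDictionary pieceTransvPlus cntTransvPlus)
    (h2 : PieceCountDictionary pieceTransvMinus cntTransvMinus) (h3 : PieceCountDictionary pieceReg cntReg) :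
    ∀ j : Fin 4, PieceCountDictionary (gselStar j) (cntStar j) := by
  intro j
  fin_cases j
  exacts [h0, h1, h2, h3]

/-- **UNIT (ii-G) ASSEMBLY, CLOSED MODULO THE REGISTERED-SHAPE STUBS**: `∀ j, PieceCountDictionary (gselStar j) (cntStar j)` (ED. 2: SORRY-FREE, `--axioms` = TRIO —
all four components `unit0 ∕ transvPlus ∕ transvMinus ∕ reg` are PAID by name).  Consumed by unit U4_Rows (the piece rows and the piece table). [cite: Kottwitz1986BaseChangeUnits, §1 pp. 240–241] -/
theorem unitTwoG_pieceCountDictionary_gselStar : ∀ j : Fin 4, PieceCountDictionary (gselStar j) (cntStar j) :=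
  pieceCountDictionary_gselStar_of unitTwoG_dict_unit0 stub_U2G_dict_transvPlus stub_U2G_dict_transvMinus stub_U2G_dict_reg

/-- **UNIT (ii-G) EXPORT FOR THE EDGE LAW ((K-1)(c))**: the dictionary of `g_E` with the fixed-edge count (through exactly `stub_U2G_dict_edge`). [cite: Kottwitz1986BaseChangeUnits, §1 pp. 240–241] -/
theorem unitTwoG_pieceCountDictionary_edge : PieceCountDictionary pieceEdge cntEdge := stub_U2G_dict_edge

end Summit.HodgeConjecture.HodgeConjecture.Cruxes.H413.F0P3cDyRamFourFrame.U2GCensus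

end
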